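import Summits.Ventures.YMGap.RobustBall.ScreenedStabilityStar
import Summits.Ventures.YMGap.RobustBall.RobustStarDoorZd
import Summits.Ventures.YMGap.RobustBall.TorusRowsSU2Star
import HarnessLib

/-!
# Venture YMGap, track ROBUST-BALL (Y2) — screened state stability through the star door: the gauge-invariant tier-1 ball and the
# `SU(2)` Wilson point up to `β_W = 1/3`

HONEST FRAMING. WHAT THIS IS: a venture file (cell `pub-ymgap`, track Y2 ROBUST-BALL, seat rb-p1, theorems only): cells of
`ScreenedStabilityStar.abs_integral_sub_integral_le_of_perturbation_screened_star`.
* `screenedStabilityStar_of_memBallZdG` — for every member of ds-2's gauge-invariant ball `MemBallZdG ε₀ ε₁ R` inside the robust star door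
  (hypotheses of `starWindowBoundZdR_of_memBallZdG`, received sum `ρ ≤ ρ₀ < 1`), every bounded adapted listed modification `V` with window loads
  `≤ B₁` everywhere and `≤ B₀` on the stars centred within `r` of `Λ_F`, every DLR pair and every Lipschitz cylinder `F`:
  `|∫ F dμ − ∫ F dν| ≤ (2√N/(1−ρ₀))·(min(e^{B₀}−1,2) + min(e^{B₁}−1,2)·ρ₀^{⌊max(r−1,0)/(max R 1+4)⌋})·#Λ_F·K_F`;
* `su2_screenedStabilityStar` — the `SU(2)`, `ℤ⁴` schema on the cell's star certificates; `su2_screenedStabilityStar_upTo_oneThird` — ONE explicit cell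
  for every `0 ≤ β_W ≤ 1/3` on `MemBallZdG (3/125) (3/250) R` (`ρ₀ = 399/400`); ★ `su2_wilson_screenedStabilityStar_upTo_oneThird` — THE `SU(2)` WILSON
  STATE ON `ℤ⁴` IS QUASI-LOCAL IN THE ACTION FOR EVERY `0 ≤ β_W ≤ 1/3`: a modification of any strength whose window loads vanish on the stars within
  `r` of `Λ_F` moves `⟨F⟩` by at most `800√2·min(e^{B₁}−1,2)·(399/400)^{⌊max(r−1,0)/5⌋}·#Λ_F·K_F`.
WHAT THIS IS NOT: sharp constants (the `upTo` cell trades the rate for one formula on the whole segment); lattice strong coupling only; nothing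
about the continuum limit or a Clay-sense mass gap.
-/

noncomputable section

open MeasureTheory ProbabilityTheory Function Finset Real
open scoped NNReal
open Literature.Probability.LatticeModels
open Literature.Probability.LatticeModels.DobrushinMetric (IsLipBound)
open Literature.MathematicalPhysics.QuantumLattice
open Literature.MathematicalPhysics.QuantumFieldTheory hiding ZdEdge Site
open Literature.MathematicalPhysics.QuantumFieldTheory.Balaban1983to89.StrongCouplingDobrushinWindow (OneLinkKRModulus)
open Summit.Ventures.YMGap.DSWindowZd
open Summit.Ventures.YMGap.StarResolventDim (gaugeR doorPoly Delta)

namespace Summit.Ventures.YMGap.RobustBall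

variable {d N : ℕ}

/-- **SCREENED STATE STABILITY ON THE GAUGE-INVARIANT TIER-1 BALL THROUGH THE ROBUST STAR DOOR** (hypotheses of ds-2's
`starWindowBoundZdR_of_memBallZdG`, received sum `ρ ≤ ρ₀ < 1`; cylinder form). -/
theorem screenedStabilityStar_of_memBallZdG (hd : 2 ≤ d) (hN : 1 ≤ N) {β ε₀ ε₁ Rm K c lam θ ρ ρ₀ B₀ B₁ r : ℝ}
    {R Kn : ℕ} (hK : 0 ≤ K) (hRm : |(N : ℝ) * β| / N * (2 * ((d : ℝ) - 1)) ≤ Rm) (hmod : OneLinkKRModulus N Rm K)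
    (hε₁ : 0 ≤ ε₁) (hc : K * Real.exp ε₀ * (1 + 2 * Real.sqrt N * ε₁) * (|(N : ℝ) * β| / N) ≤ c)
    (hlam : Real.sqrt N * ε₁ ≤ lam) (hθ : θ = (2 * (d : ℝ) - 2) * c + lam) (hθ1 : θ < 1)
    (hcd : doorPoly d c < 1) (hρ : ρ = gaugeR d c + (lam + θ ^ Kn * (4 * d * lam)) / (1 - θ)) (hρle : ρ ≤ ρ₀)
    (hρ00 : 0 ≤ ρ₀) (hρ1 : ρ₀ < 1)
    {W : Potential (ZdEdge d) (SUN N)} {supp : Finset (ZdEdge d) → Finset (Finset (ZdEdge d))}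
    (hW : MemBallZdG ε₀ ε₁ R W supp)
    {V : Potential (ZdEdge d) (SUN N)} (hV : V.IsAdapted) (hVb : ∀ X, ∃ C, ∀ U, |V X U| ≤ C)
    {suppV : Finset (ZdEdge d) → Finset (Finset (ZdEdge d))} (hsuppV : V.IsSupportedBy suppV)
    {oscV : Finset (ZdEdge d) → ZdEdge d → ℝ} (hoscV : ∀ X, Dobrushin.IsOscBound (V X) (oscV X))
    (hB₀ : 0 ≤ B₀) (hB₁ : 0 ≤ B₁) {Λ : Finset (ZdEdge d)}
    (hfar : ∀ cc : ZdEdge d, windowLoad d suppV oscV (starWinZd cc) ≤ B₁)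
    (hnear : ∀ cc : ZdEdge d, linkSetDist Λ cc ≤ r → windowLoad d suppV oscV (starWinZd cc) ≤ B₀)
    {μ ν : Measure (LGConfig d (SUN N))}
    (hμ : μ ∈ perturbedGibbsMeasures (d := d) (fundamentalRep (Fin N)) (N * β) W supp)
    (hν : ν ∈ perturbedGibbsMeasures (d := d) (fundamentalRep (Fin N)) (N * β) (W + V)
      (fun Λ' => supp Λ' ∪ suppV Λ'))
    {F : LGConfig d (SUN N) → ℝ} {KF : ℝ≥0} (hF : IsLipschitzCylinder (fundamentalRep (Fin N)) F Λ KF) :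
    |(∫ σ, F σ ∂μ) - ∫ σ, F σ ∂ν| ≤
      2 * Real.sqrt N / (1 - ρ₀) * (min (Real.exp B₀ - 1) 2 + min (Real.exp B₁ - 1) 2 * ρ₀ ^ ⌊max (r - 1) 0 / (max R 1 + 4 : ℕ)⌋₊) *
        (Λ.card * KF) := by
  classical
  have hwin := (starWindowBoundZdR_of_memBallZdG hd hN hK hRm hmod hε₁ hc hlam hθ hθ1 hcd hρ hW).mono_rho hρle
  have hD : R + 2 ≤ max R 1 + 2 := by omega
  have hA : ∀ a b : SUN N, dist (suEntries a) (suEntries b) ≤ 1 * suFrobDist a b :=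
    fun a b => by rw [one_mul]; exact dist_suEntries_le_suFrobDist a b
  have key := abs_integral_sub_integral_le_of_perturbation_screened_star hW.continuous hW.dependsOn hW.supportedBy hW.range hD
    hρ00 hρ1 hwin hV hVb hsuppV hoscV hB₀ hB₁ hfar hnear hμ hν hF.measurable hF.abs_le hF.dependsOn (hF.isLipBound zero_le_one hA)
  have hsum : ∑ y ∈ Λ, (if y ∈ Λ then (1 : ℝ) * (KF : ℝ) else 0) = Λ.card * KF := by
    rw [Finset.sum_ite_of_true (fun y hy => hy), Finset.sum_const, nsmul_eq_mul, one_mul]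
  have e4 : (max R 1 + 2 + 2 : ℕ) = max R 1 + 4 := by omega
  rw [hsum, e4] at key
  exact key

/-- **`SU(2)`, `ℤ⁴` — SCREENED STATE STABILITY THROUGH THE STAR DOOR, schema on the cell's certificates** (the parameters of
`su2_localScreeningOnBallZdG_star`: `0 ≤ β_W ≤ 2/3`, `E ≥ e^{ε₀}`, `S ≥ √2`, `c ≥ E(1+2Sε₁)β_W/4`, `λ ≥ Sε₁`, `θ = 6c + λ < 1`, `doorPoly 4 c < 1`,
received sum `≤ ρ₀ < 1`): on `MemBallZdG ε₀ ε₁ R` at bare coupling `β_W/2`, the bound of `screenedStabilityStar_of_memBallZdG` with `N = 2`. -/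
theorem su2_screenedStabilityStar (Kn : ℕ) {βW ε₀ ε₁ c lam E S ρ₀ B₀ B₁ r : ℝ} (hβ0 : 0 ≤ βW) (hβ : βW ≤ 2 / 3)
    (hε₁ : 0 ≤ ε₁) (hE : Real.exp ε₀ ≤ E) (hS : Real.sqrt 2 ≤ S) (hc : E * (1 + 2 * S * ε₁) * (βW / 4) ≤ c)
    (hlam : S * ε₁ ≤ lam) (hθ1 : 6 * c + lam < 1) (hcd : doorPoly 4 c < 1)
    (hρ0 : gaugeR 4 c + (lam + (6 * c + lam) ^ Kn * (16 * lam)) / (1 - (6 * c + lam)) ≤ ρ₀) (hρ00 : 0 ≤ ρ₀) (hρ1 : ρ₀ < 1) {R : ℕ}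
    {W : Potential (ZdEdge 4) (SUN 2)} {supp : Finset (ZdEdge 4) → Finset (Finset (ZdEdge 4))}
    (hW : MemBallZdG ε₀ ε₁ R W supp)
    {V : Potential (ZdEdge 4) (SUN 2)} (hV : V.IsAdapted) (hVb : ∀ X, ∃ C, ∀ U, |V X U| ≤ C)
    {suppV : Finset (ZdEdge 4) → Finset (Finset (ZdEdge 4))} (hsuppV : V.IsSupportedBy suppV)
    {oscV : Finset (ZdEdge 4) → ZdEdge 4 → ℝ} (hoscV : ∀ X, Dobrushin.IsOscBound (V X) (oscV X))
    (hB₀ : 0 ≤ B₀) (hB₁ : 0 ≤ B₁) {Λ : Finset (ZdEdge 4)}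
    (hfar : ∀ cc : ZdEdge 4, windowLoad 4 suppV oscV (starWinZd cc) ≤ B₁)
    (hnear : ∀ cc : ZdEdge 4, linkSetDist Λ cc ≤ r → windowLoad 4 suppV oscV (starWinZd cc) ≤ B₀)
    {μ ν : Measure (LGConfig 4 (SUN 2))}
    (hμ : μ ∈ perturbedGibbsMeasures (d := 4) (fundamentalRep (Fin 2)) (2 * (βW / 4)) W supp)
    (hν : ν ∈ perturbedGibbsMeasures (d := 4) (fundamentalRep (Fin 2)) (2 * (βW / 4)) (W + V) (fun Λ' => supp Λ' ∪ suppV Λ'))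
    {F : LGConfig 4 (SUN 2) → ℝ} {KF : ℝ≥0} (hF : IsLipschitzCylinder (fundamentalRep (Fin 2)) F Λ KF) :
    |(∫ σ, F σ ∂μ) - ∫ σ, F σ ∂ν| ≤
      2 * Real.sqrt 2 / (1 - ρ₀) * (min (Real.exp B₀ - 1) 2 + min (Real.exp B₁ - 1) 2 * ρ₀ ^ ⌊max (r - 1) 0 / (max R 1 + 4 : ℕ)⌋₊) *
        (Λ.card * KF) := by
  have hS0 : 0 ≤ S := (Real.sqrt_nonneg _).trans hS
  have hE0 : 0 ≤ E := (Real.exp_pos _).le.trans hE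
  set θ : ℝ := 6 * c + lam with hθ
  set ρ : ℝ := gaugeR 4 c + (lam + θ ^ Kn * (16 * lam)) / (1 - θ) with hρ
  have habs : |((2 : ℕ) : ℝ) * (βW / 4)| / ((2 : ℕ) : ℝ) = βW / 4 := by
    rw [abs_of_nonneg (by positivity)]
    push_cast
    ring
  have hR : |((2 : ℕ) : ℝ) * (βW / 4)| / ((2 : ℕ) : ℝ) * (2 * (((4 : ℕ) : ℝ) - 1)) ≤ 3 * βW / 2 := by
    rw [habs]; push_cast; linarith
  have hc' : (1 : ℝ) * Real.exp ε₀ * (1 + 2 * Real.sqrt ((2 : ℕ) : ℝ) * ε₁) *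
      (|((2 : ℕ) : ℝ) * (βW / 4)| / ((2 : ℕ) : ℝ)) ≤ c := by
    refine le_trans ?_ hc
    have h1 : Real.sqrt ((2 : ℕ) : ℝ) = Real.sqrt 2 := by norm_num
    rw [h1, one_mul, habs]
    have hb : 0 ≤ βW / 4 := by positivity
    calc Real.exp ε₀ * (1 + 2 * Real.sqrt 2 * ε₁) * (βW / 4) ≤ E * (1 + 2 * Real.sqrt 2 * ε₁) * (βW / 4) := by
          gcongr
      _ ≤ E * (1 + 2 * S * ε₁) * (βW / 4) := by gcongr
  have hlam' : Real.sqrt ((2 : ℕ) : ℝ) * ε₁ ≤ lam := by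
    have h1 : Real.sqrt ((2 : ℕ) : ℝ) = Real.sqrt 2 := by norm_num
    rw [h1]; exact le_trans (mul_le_mul_of_nonneg_right hS hε₁) hlam
  have hθ' : θ = (2 * ((4 : ℕ) : ℝ) - 2) * c + lam := by rw [hθ]; push_cast; ring
  have hρ' : ρ = gaugeR 4 c + (lam + θ ^ Kn * (4 * ((4 : ℕ) : ℝ) * lam)) / (1 - θ) := by rw [hρ]; push_cast; ring
  have h2 : (2 * Real.sqrt ((2 : ℕ) : ℝ) : ℝ) = 2 * Real.sqrt 2 := by norm_num
  have hμ' : μ ∈ perturbedGibbsMeasures (d := 4) (fundamentalRep (Fin 2)) ((2 : ℕ) * (βW / 4)) W supp := by simpa using hμ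
  have hν' : ν ∈ perturbedGibbsMeasures (d := 4) (fundamentalRep (Fin 2)) ((2 : ℕ) * (βW / 4)) (W + V)
      (fun Λ' => supp Λ' ∪ suppV Λ') := by simpa using hν
  rw [← h2]
  exact screenedStabilityStar_of_memBallZdG (d := 4) (N := 2) (by norm_num) (by norm_num) zero_le_one hR
    (su2_quarterModulus hβ) hε₁ hc' hlam' hθ' hθ1 hcd hρ' hρ0 hρ00 hρ1 hW hV hVb hsuppV hoscV hB₀ hB₁ hfar hnear hμ' hν' hF

/-- **UP TO `β_W = 1/3`, ONE EXPLICIT FORMULA** on `MemBallZdG (3/125) (3/250) R` (received sum `≤ 399/400` along the segment):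
`|∫ F dμ − ∫ F dν| ≤ 800√2·(min(e^{B₀}−1,2) + min(e^{B₁}−1,2)·(399/400)^{⌊max(r−1,0)/(max R 1+4)⌋})·#Λ_F·K_F`. -/
theorem su2_screenedStabilityStar_upTo_oneThird {βW B₀ B₁ r : ℝ} (h0 : 0 ≤ βW) (h : βW ≤ 1 / 3) {R : ℕ}
    {W : Potential (ZdEdge 4) (SUN 2)} {supp : Finset (ZdEdge 4) → Finset (Finset (ZdEdge 4))}
    (hW : MemBallZdG (3 / 125) (3 / 250) R W supp)
    {V : Potential (ZdEdge 4) (SUN 2)} (hV : V.IsAdapted) (hVb : ∀ X, ∃ C, ∀ U, |V X U| ≤ C)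
    {suppV : Finset (ZdEdge 4) → Finset (Finset (ZdEdge 4))} (hsuppV : V.IsSupportedBy suppV)
    {oscV : Finset (ZdEdge 4) → ZdEdge 4 → ℝ} (hoscV : ∀ X, Dobrushin.IsOscBound (V X) (oscV X))
    (hB₀ : 0 ≤ B₀) (hB₁ : 0 ≤ B₁) {Λ : Finset (ZdEdge 4)}
    (hfar : ∀ cc : ZdEdge 4, windowLoad 4 suppV oscV (starWinZd cc) ≤ B₁)
    (hnear : ∀ cc : ZdEdge 4, linkSetDist Λ cc ≤ r → windowLoad 4 suppV oscV (starWinZd cc) ≤ B₀)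
    {μ ν : Measure (LGConfig 4 (SUN 2))}
    (hμ : μ ∈ perturbedGibbsMeasures (d := 4) (fundamentalRep (Fin 2)) (2 * (βW / 4)) W supp)
    (hν : ν ∈ perturbedGibbsMeasures (d := 4) (fundamentalRep (Fin 2)) (2 * (βW / 4)) (W + V) (fun Λ' => supp Λ' ∪ suppV Λ'))
    {F : LGConfig 4 (SUN 2) → ℝ} {KF : ℝ≥0} (hF : IsLipschitzCylinder (fundamentalRep (Fin 2)) F Λ KF) :
    |(∫ σ, F σ ∂μ) - ∫ σ, F σ ∂ν| ≤
      800 * Real.sqrt 2 * (min (Real.exp B₀ - 1) 2 + min (Real.exp B₁ - 1) 2 * (399 / 400 : ℝ) ^ ⌊max (r - 1) 0 / (max R 1 + 4 : ℕ)⌋₊) *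
        (Λ.card * KF) := by
  have key := su2_screenedStabilityStar 20 (ε₀ := 3 / 125) (ε₁ := 3 / 250) (c := 17651 / 200000)
    (lam := 16971 / 1000000) (E := 1024291 / 1000000) (S := 1.41422) (ρ₀ := 399 / 400) h0 (h.trans (by norm_num))
    (by norm_num) exp_le_3_125_star sqrt_two_le ?_ (by norm_num) (by norm_num) (by unfold doorPoly; norm_num)
    (by unfold gaugeR Delta; norm_num) (by norm_num) (by norm_num) hW hV hVb hsuppV hoscV hB₀ hB₁ hfar hnear hμ hν hF
  · have e : 2 * Real.sqrt 2 / (1 - (399 / 400 : ℝ)) = 800 * Real.sqrt 2 := by norm_num; ring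
    rw [e] at key
    exact key
  · calc (1024291 / 1000000 : ℝ) * (1 + 2 * 1.41422 * (3 / 250)) * (βW / 4)
        ≤ 1024291 / 1000000 * (1 + 2 * 1.41422 * (3 / 250)) * ((1 / 3) / 4) := by gcongr
      _ ≤ 17651 / 200000 := by norm_num

/-- ★ **THE `SU(2)` WILSON STATE ON `ℤ⁴` IS QUASI-LOCAL IN THE ACTION FOR EVERY `0 ≤ β_W ≤ 1/3`.**  For every bounded adapted listed
modification `V` of ANY strength (window loads `≤ B₁` on every vertex star, `≤ B₀` on the stars centred within `r` of `Λ_F`), every DLR `μ` of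
`SU(2)` lattice Yang–Mills at `β_W` (bare coupling `β_W/2`), EVERY DLR `ν` of the modified action and every Lipschitz cylinder `F`:
`|∫ F dμ − ∫ F dν| ≤ 800√2·(min(e^{B₀}−1,2) + min(e^{B₁}−1,2)·(399/400)^{⌊max(r−1,0)/5⌋})·#Λ_F·K_F`. -/
theorem su2_wilson_screenedStabilityStar_upTo_oneThird {βW B₀ B₁ r : ℝ} (h0 : 0 ≤ βW) (h1 : βW ≤ 1 / 3)
    {V : Potential (ZdEdge 4) (SUN 2)} (hV : V.IsAdapted) (hVb : ∀ X, ∃ C, ∀ U, |V X U| ≤ C)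
    {suppV : Finset (ZdEdge 4) → Finset (Finset (ZdEdge 4))} (hsuppV : V.IsSupportedBy suppV)
    {oscV : Finset (ZdEdge 4) → ZdEdge 4 → ℝ} (hoscV : ∀ X, Dobrushin.IsOscBound (V X) (oscV X))
    (hB₀ : 0 ≤ B₀) (hB₁ : 0 ≤ B₁) {Λ : Finset (ZdEdge 4)}
    (hfar : ∀ cc : ZdEdge 4, windowLoad 4 suppV oscV (starWinZd cc) ≤ B₁)
    (hnear : ∀ cc : ZdEdge 4, linkSetDist Λ cc ≤ r → windowLoad 4 suppV oscV (starWinZd cc) ≤ B₀)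
    {μ ν : Measure (LGConfig 4 (SUN 2))}
    (hμ : μ ∈ ymGibbsMeasures (d := 4) (fundamentalRep (Fin 2)) (2 * (βW / 4)))
    (hν : ν ∈ perturbedGibbsMeasures (d := 4) (fundamentalRep (Fin 2)) (2 * (βW / 4)) V suppV)
    {F : LGConfig 4 (SUN 2) → ℝ} {KF : ℝ≥0} (hF : IsLipschitzCylinder (fundamentalRep (Fin 2)) F Λ KF) :
    |(∫ σ, F σ ∂μ) - ∫ σ, F σ ∂ν| ≤
      800 * Real.sqrt 2 * (min (Real.exp B₀ - 1) 2 + min (Real.exp B₁ - 1) 2 * (399 / 400 : ℝ) ^ ⌊max (r - 1) 0 / (5 : ℕ)⌋₊) *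
        (Λ.card * KF) := by
  have hmem : MemBallZdG (N := 2) (d := 4) (3 / 125) (3 / 250) 0 0 (fun _ => (∅ : Finset (Finset (ZdEdge 4)))) :=
    memBallZdG_zero (by norm_num) (by norm_num) 0
  have hμ' : μ ∈ perturbedGibbsMeasures (d := 4) (fundamentalRep (Fin 2)) (2 * (βW / 4))
      (0 : Potential (ZdEdge 4) (SUN 2)) (fun _ => ∅) := by
    rw [perturbedGibbsMeasures_zero]; exact hμ
  have hν' : ν ∈ perturbedGibbsMeasures (d := 4) (fundamentalRep (Fin 2)) (2 * (βW / 4))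
      ((0 : Potential (ZdEdge 4) (SUN 2)) + V)
      (fun Λ' => (fun _ : Finset (ZdEdge 4) => (∅ : Finset (Finset (ZdEdge 4)))) Λ' ∪ suppV Λ') := by
    simpa only [zero_add, Finset.empty_union] using hν
  have key := su2_screenedStabilityStar_upTo_oneThird (R := 0) h0 h1 hmem hV hVb hsuppV hoscV hB₀ hB₁ hfar hnear hμ' hν' hF
  have e5 : (max 0 1 + 4 : ℕ) = 5 := by norm_num
  rw [e5] at key
  exact key

end Summit.Ventures.YMGap.RobustBall

end
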